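import Summits.BirchSwinnertonDyer.BirchSwinnertonDyer.Theorems.ByReductionTypeAtTwoSupersingularTwoAdicImageCriterion
import Literature.NumberTheory.EllipticCurves.Rank1Residual.Predicates
import Literature.NumberTheory.EllipticCurves.Rank1Residual.X9SmallImage
import HarnessLib

/-!
# D-imc-81 at the GALOIS level (typed candidates, -imc g30): on good supersingular reduction at `2`, the printed
Euler-system image hypothesis (im) = Rubin's `Hyp(ℚ_∞, T₂E)` (ii) = Kato Thm. 13.4 (3)'s `σ` = KLZ Hyp(BI) (ii) is
EQUIVALENT to 2-adic surjectivity

Crux `SupersingularRankZeroAtTwo` (stmt-BirchSwinnertonDyer-19097), line `odd_blind_package`, stub 3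
`stub_allMuFlatOfNonSurj : MuFlatOfNonSurjAtTwo` (habitat `GoodSS W 2 ∧ ¬ TwoAdicSurjective W`).

The tree's LITERAL predicate for the hypothesis is `Literature.NumberTheory.EllipticCurves.Rank1Residual.BigIm W p`
(`Rank1Residual/Predicates.lean`: "∃ σ ∈ Γ_ℚ fixing every `p`-power root of unity with
`T_pE ⧸ range (ρ_{E,p}(σ) − 1) ≃ₗ[ℤ_p] ℤ_p`" = Burungale–Castella–Skinner's (im) = Kato, Astérisque 295, Thm. 13.4 (3)
[corpus:paper:doi-10-24033-ast-639 p0111] = Rubin, *Euler Systems*, Hyp(ℚ_∞,T)(ii) = Kings–Loeffler–Zerbes Hyp(BI)(ii)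
[corpus:paper:arxiv-1503.02888 p0091]).  The catalogued barrier `Literature/Barriers/BirchSwinnertonDyer/EulerSystemBigImageAtSmallImage`
(`Rank1Residual.not_bigIm_of_irr_of_not_surj`: `irr(p) ∧ ¬surj(p) ⟹ ¬BigIm`) is VACUOUS on this crux: `GoodSS W 2` forces
`ρ̄_{E,2}` onto (`P2.surj_two_of_goodSS_two`-type facts), so `¬surj(2)` never holds.  The workfile
`Cruxes/SupersingularRankZeroAtTwo/D81TauObstructionAtTwo.lean` (@67c49c81f22c) proved the LEVEL-4 obstruction in matrix form
(`D81TauObstructionAtTwo.par_rhoMod4_eq_one_of_det_eq_one_of_trace_eq_two`,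
`D81TauObstructionAtTwo.twoAdicSurjective_iff_exists_rubinShape_mod_four`).  This file TYPES the Galois-level statements the
matrix theorems are designed to prove, over tree declarations only, as candidate Props (nothing asserted):

* K81-A `BigImTwoForcesTwoAdicSurjectiveOnGoodSS` — (im) at `p = 2` ⟹ `TwoAdicSurjective` on `GoodSS W 2`.  BARRIER direction:
  on stub 3's whole habitat (the Dokchitser–Dokchitser family `j = −4t³(t+8)`; Cremona `N < 5·10⁵`: 304 good-ss classes, all
  `a₂ = 0`; X5@2 rank 0: 107217l1, 184041bk1) the printed integral Euler-system theorems have an UNSATISFIABLE hypothesis,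
  although the mod-2 image is surjective there.
* K81-B `TwoAdicSurjectiveGivesBigImTwo` — the converse ((1 1; 0 1) ∈ SL₂(ℤ₂) = ρ(G_{ℚ(μ_{2^∞})}) when the 2-adic image is full).
* K81-AB the equivalence on `GoodSS W 2`.

PROOF PLAN for K81-A (turnkey for a prover/typer seat; every ingredient is a tree declaration):
(1) `rintro ⟨σ, hσ, ⟨Ψ⟩⟩`; (2) det: `TwoAdicImageModFourArithmeticProofs` `smul_zeta` (`σ • ζ = ζ ^ (det M σ).val`, `ζ = e₄(P₀,Q₀)` of
exact order 4) and `hσ ζ 2` give `(LevelFour.M W two_ne_zero σ).det = 1`; (3) level-4 cyclicity: with `π₄ = TateModule.proj 2 2`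
(onto `E[4]`, kernel `4·T₂E`, `Γ_ℚ`-equivariant — exactly as `WeierstrassCurve.isEmpty_quotient_range_galoisRepTate_sub_one_equiv`
does with `proj p 1`), `Ψ` makes `E[4] ⧸ (σ−1)E[4]` cyclic of order 4, generated by the image of a lift of `Ψ⁻¹ 1`; (4) in the
frame `LevelFour.frame4` (`TwoAdicImageModFourArithmeticProofs` l.130: `frame4 (σ • frame4⁻¹ eⱼ) i = M σ i j`) this says
`coker (M σ − 1 : (ℤ/4)² → (ℤ/4)²) ≅ ℤ/4`, whence (Smith normal form over `ℤ/4`, a 2×2 computation) `tr (M σ) = 2` and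
`Q4.par (tup (M σ)) ≠ (1,0,0,1)` (if `M σ ≡ 1 (mod 2)` the cokernel surjects onto `(ℤ/2)²`); (5) contradiction with
`D81TauObstructionAtTwo.par_rhoMod4_eq_one_of_det_eq_one_of_trace_eq_two hss hns σ hdet htr`.  Steps (2)–(4) are the
"level-4 transvection criterion", the analogue one level up of `TateModuleTransvectionCriterionProofs` (p177495).

CHEAPEST FALSIFIER (run, `MEMO-imc-data/dimc81/gl2mod4.py` a6f0af00f5af4c89): enumerate ℍ ⊂ GL₂(ℤ/4) (order 24): no `h ∈ ℍ`
with `det h = 1` has `coker(h − 1) ≅ ℤ/4` (all `h` with `det h = 1, tr h = 2` are `≡ 1 mod 2`) — consistent with K81-A; and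
`(1 1; 0 1) ∈ SL₂(ℤ/4)` has `coker = ℤ/4` — consistent with K81-B.  BC5 witness = the D–D census tables
(`x5_goodss_ddfamily.tsv` d8b59baecc43b8c0, `cremona_goodss_ddfamily.tsv` d5d8fe21c40c2f44).

## References
* [Kato2004] K. Kato, Astérisque 295 (2004), Thm. 13.4 (3), p. 226 (PDF p0111); (12.5.2), p. 222 (p0107).
* [KingsLoefflerZerbes2017] G. Kings, D. Loeffler, S. Zerbes, Camb. J. Math. 5 (2017) = arXiv:1503.02888, Hyp. 11.1.2 (p0091).
* [BurungaleCastellaSkinner2025] IMRN 2025 = arXiv:2405.00270v2, p. 2 (im).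
* [DokchitserDokchitserMathZ2012] T. and V. Dokchitser, Math. Z. 272 (2012), Lemma p. 962 and Theorem (2).
* [Rubin2000EulerSystems] K. Rubin, *Euler Systems*, Ann. of Math. Stud. 147 (2000), §2.3, Hyp(K_∞,T) (not held; acq-02907).

**STATUS v2/v3 (-imc g30, 2026-08-31T07:15Z / 07:50Z): ALL THREE CANDIDATES K81-A/B/AB ARE NOW THEOREMS; v3 adds the typed candidate K81-D below** — crux workfile
`Cruxes/SupersingularRankZeroAtTwo/K81BigImLevelFourAtTwo.lean` v2 @90c9399f74e3 (sha16 bc1d8a514fb2fbf8, rc 0, 0 sorry, axioms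
{propext, Classical.choice, Quot.sound}): K81-A = `K81BigImLevelFour.bigImTwoForcesTwoAdicSurjectiveOnGoodSS_holds` (level-4
transvection criterion + the τ-obstruction in ℍ), K81-B = `K81BigImLevelFour.twoAdicSurjectiveGivesBigImTwo_holds` (= tree
`WeierstrassCurve.exists_quotient_range_galoisRepTate_sub_one_equiv_of_forall_surjective` at `p = 2`), K81-AB =
`K81BigImLevelFour.bigImTwoIffTwoAdicSurjectiveOnGoodSS_holds`, and the `j`-form `K81BigImLevelFour.bigIm_two_iff_forall_j_ne_of_goodSS_two`
(on `GoodSS W 2`: (im) at `2` ⟺ `∀ t : ℚ, j(E) ≠ −4t³(t+8)`).  The `def`s below are kept verbatim as the typed statements of record.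
-/

set_option autoImplicit false
set_option linter.dupNamespace false

noncomputable section

open scoped Classical

namespace Summit.BirchSwinnertonDyer.BirchSwinnertonDyer.Cruxes.SupersingularRankZeroAtTwo.K81GaloisLevel

open Literature.NumberTheory.EllipticCurves Literature.NumberTheory.EllipticCurves.Rank1Residual
open Summit.BirchSwinnertonDyer.Rank1Residual.X5.O1

/-- **K81-A (candidate; barrier direction).**  On good supersingular reduction at `2`, hypothesis (im) at `p = 2`
(`Rank1Residual.BigIm W 2` = Kato Thm. 13.4 (3)'s `σ` = Rubin's Hyp(ℚ_∞,T₂E)(ii) = KLZ Hyp(BI)(ii)) FORCES 2-adic surjectivity.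
Contrapositive: on `GoodSS W 2 ∧ ¬ TwoAdicSurjective W` (= `j(E) = −4t³(t+8)`, stub 3's habitat) no `σ ∈ G_{ℚ(μ_{2^∞})}` has
`T₂E/(σ−1)T₂E ≅ ℤ₂`.  Why it might fail: it should not — steps (2)–(5) of the plan are each decided; the risk is only in the
typing of `BigIm`'s root-of-unity clause vs `smul_zeta`'s `ζ`. [cite: Kato2004, Thm. 13.4 (3)]
[cite: DokchitserDokchitserMathZ2012, Lemma (p. 962)] -/
def BigImTwoForcesTwoAdicSurjectiveOnGoodSS : Prop :=
  ∀ (W : WeierstrassCurve ℚ) [W.IsElliptic] [W.IsGloballyMinimal], GoodSS W 2 → BigIm W 2 → TwoAdicSurjective W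

/-- **K81-B (candidate; converse).**  2-adic surjectivity gives (im) at `2`: `ρ_{E,2^∞}(G_{ℚ(μ_{2^∞})}) = SL₂(ℤ₂) ∋ τ = (1 1; 0 1)`,
`T/(τ−1)T = ℤ₂² / (0 ⊕ ℤ₂)·swap ≅ ℤ₂`.  Why it might fail: needs `det ρ_{E,2^∞} = χ_{2^∞}` on the integral Tate module and the
passage `∀ n, ρ̄_{2ⁿ}` onto ⟹ closed image = GL₂(ℤ₂) (`Kato2004.imageContainsSL2_iff_forall_hasSurjectiveModNGaloisRep` shape);
no reduction hypothesis. [cite: Serre1972, §4] [cite: BurungaleCastellaSkinner2025, p. 2 (im), "implied by surj(p) for p ≥ 5"] -/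
def TwoAdicSurjectiveGivesBigImTwo : Prop :=
  ∀ (W : WeierstrassCurve ℚ) [W.IsElliptic], TwoAdicSurjective W → BigIm W 2

/-- **K81-AB (candidate; the displayed equivalence of MEMO-imc §10.113 (A)).**  On `GoodSS W 2`:
(im) at `2` ⟺ `TwoAdicSurjective W`. [cite: Kato2004, Thm. 13.4 (3)] [cite: DokchitserDokchitserMathZ2012, Theorem (2)] -/
def BigImTwoIffTwoAdicSurjectiveOnGoodSS : Prop :=
  ∀ (W : WeierstrassCurve ℚ) [W.IsElliptic] [W.IsGloballyMinimal], GoodSS W 2 → (BigIm W 2 ↔ TwoAdicSurjective W)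

/-- Bookkeeping: K81-A ∧ K81-B ⟹ K81-AB. [folklore] -/
theorem bigImTwoIff_of (hA : BigImTwoForcesTwoAdicSurjectiveOnGoodSS) (hB : TwoAdicSurjectiveGivesBigImTwo) :
    BigImTwoIffTwoAdicSurjectiveOnGoodSS :=
  fun W _ _ hss ↦ ⟨hA W hss, hB W⟩

/-- Bookkeeping: the catalogued small-image barrier is VACUOUS here — its hypothesis `¬ surj(2)` contradicts the mod-2
surjectivity packaged in `TwoAdicSurjective` at `n = 1`; what K81-A adds is the obstruction one level up (mod 4), where
`surj(2)` holds and `surj(4)` fails. [folklore] -/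
theorem twoAdicSurjective_one (W : WeierstrassCurve ℚ) (h : TwoAdicSurjective W) : W.HasSurjectiveModNGaloisRep 2 := by
  simpa using h 1 one_pos

/-! ## K81-D (v3, 2026-08-31T07:50Z) — «not even with defect 2»: the minimal Euler-system defect on the D–D locus is `4`

After K81 (no `σ ∈ G_{ℚ(μ_{2^∞})}` with `T₂E/(σ−1) ≅ ℤ₂` on `X_ℍ`) the next question for a defect-tolerant Euler-system argument
(Rubin-style bounds «up to the index of `T/(τ−1)T`'s torsion») is whether `T₂E/(σ−1)T₂E ≅ ℤ₂ ⊕ ℤ/2` is available.  It is NOT: reducing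
mod `4`, such a `σ` would give `E[4]/(σ−1)E[4] ≅ ℤ/4 ⊕ ℤ/2` (order `8`), while for `σ` fixing `ζ₄` (so `det ρ̄₄(σ) = 1`) and
`Im ρ̄₄ ⊂ kℍk⁻¹` the cokernel of `ρ̄₄(σ) − 1` on `E[4] ≅ (ℤ/4)²` has order in `{1, 2, 4, 16}` — enumeration of the twelve `det = 1`
elements of `ℍ = ⟨(0 1;3 0),(0 1;1 1)⟩` (MEMO-imc §10.114-add4 table; `ℍ ∩ ker(→ GL₂(ℤ/2)) = 1 + 2·𝔽₄`, so the only `det = 1`, `tr = 2`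
classes are `±1`, with cokernels `(ℤ/4)²` and `(ℤ/2)²`).  The first AVAILABLE shape on the generic member of `X_ℍ` (2-adic image = the
full preimage of `ℍ`) is `σ ↦ (1 4; 0 1)`: `T₂E/(σ−1)T₂E ≅ ℤ₂ ⊕ ℤ/4` — defect exponent `4`.  K81-D is the level-4 statement (stronger
than the Tate-module one, and typed over tree declarations only). -/

/-- **K81-D (candidate; «no defect-2 element», level-4 form).**  For `E/ℚ` (globally minimal) in stub 3's habitat
(`GoodSS W 2 ∧ ¬ TwoAdicSurjective W`) and every `σ ∈ Γ_ℚ` fixing the fourth roots of unity, the cokernel of `ρ̄_{E,4}(σ) − 1` on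
`E[4]` does NOT have order `8` (so `T₂E/(σ−1)T₂E ≇ ℤ₂ ⊕ ℤ/2`; with K81, the minimal defect of a Chebotarev element for an Euler-system
argument at `2` on the D–D locus is `4`).  Why it might fail: it should not — `det ρ̄₄(σ) = 1` (`LevelFour.smul_zeta`), `Im ρ̄₄ ⊂ kℍk⁻¹`
(D81 / `LevelFour.conj_subset_HH_iff_exists_j_eq`), and the cokernel order is a conjugation invariant decided on the 12 elements of
`ℍ ∩ SL₂(ℤ/4)`; the only typing risk is the `AddMonoidHom` spelling of `ρ̄₄(σ) − 1`. [cite: DokchitserDokchitserMathZ2012, Lemma (p. 962)]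
[cite: Rubin2000EulerSystems, Ch. II (defect-tolerant bounds; cite-level, acq-02907)] -/
def NoOrderEightCokernelAtLevelFourOnDD : Prop :=
  ∀ (W : WeierstrassCurve ℚ) [W.IsElliptic] [W.IsGloballyMinimal], GoodSS W 2 → ¬ TwoAdicSurjective W →
    ∀ σ : Field.absoluteGaloisGroup ℚ, (∀ ζ : AlgebraicClosure ℚ, ζ ^ 4 = 1 → Field.absoluteGaloisGroup.toAlgEquiv ℚ σ ζ = ζ) →
      Nat.card (W.geomTorsion 4 ⧸
        ((Multiplicative.toAdd (W.galoisRepTorsion 4 σ)).toAddMonoidHom - AddMonoidHom.id (W.geomTorsion 4)).range) ≠ 8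

end Summit.BirchSwinnertonDyer.BirchSwinnertonDyer.Cruxes.SupersingularRankZeroAtTwo.K81GaloisLevel

end
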